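import Summits.Ventures.HSemireg.WedgeBox

/-!
# Venture HSemireg — THEOREM K∘T for the box (2/8)

HONEST FRAMING. Part of the Lean index of the computation cell `pub-hsemireg` (seat p3; Sunday enclosure of the
FORMULA-N kernel assets of seats th-7 / th-6, ENCLOSURE-PLAN-p3.md).  Finite-dimensional exterior algebra over a field ONLY:
no variety, no cohomology theory, no semiregularity map is constructed here; nothing here says that HC / HC_CM / HC_AV holds;
no Literature fact is declared or used.  The geometric DICTIONARY (why these ranks are the `HT`-side box ranks of the cell's
STRUCTURE.md §1 / theory/FORMULA-N.md) lives in theory/FORMULA-N-th7.md PART B §A.3 / §N and is NOT asserted in Lean.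

THEOREM K∘T for the BOX of two point pairs (FORMULA-N PART A §2.3 / PART B §L; th-7 theory/th7/BoxRank.lean v4 sha256/16
88aeb4a1de514ae6, l.300–527), file 2 of 8 — generators `I n := Fin (4n)` in four blocks `A 0 = X`, `A 1 = Y` (factor 1), `C 0 = X′`,
`C 1 = Y′` (factor 2); the coefficient-matrix box `boxClass c := Σ_{α,β} c α β • E_{A α ∪ C β}` and the HONEST box `fac1 a * fac2 a′`;
ranks of `θ ↦ θ ∧ box` on `⋀^k` in every degree: `4C(2n,k) − 4C(n,k)` (0 < k < n), the degree-n PURITY DROP `4C(2n,n) − 6` on the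
decomposable locus, `4C(2n,k) − 4C(n,k−n)` (n < k < 2n), `1` in degrees 0 and 2n; one citable form `finrank_range_wedgeMap_fac_mul_all`
(file 8).  No permutation sign is ever evaluated.  th-7's statements and proofs, unchanged (namespace `HSemiregBox` ↦
`Summit.Ventures.HSemireg.WedgeBox`; this family's Fin-indexed `B K n s` is its own, kept apart from `Wedge.B` / `WedgePair.B` by namespace).
Part I/2: pure and mixed relevant monomials, pivots, dual functionals, linear independence of the images, `range_eq_span_vec`.
-/

open Module Set Set.powersetCard

namespace Summit.Ventures.HSemireg.WedgeBox

variable (K : Type*) [Field K] {n : ℕ}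

variable (n)

/-- `k`-subsets of `A_α ∪ C_β` meeting both blocks. -/
def Mix (k : ℕ) (p : Fin 2 × Fin 2) : Finset (Finset (I n)) :=
  ((P n p.1 p.2).powersetCard k) \ (((A n p.1).powersetCard k) ∪ ((C n p.2).powersetCard k))

/-- `k`-subsets of `A_α`. -/
def PureA (k : ℕ) (α : Fin 2) : Finset (Finset (I n)) := (A n α).powersetCard k

/-- `k`-subsets of `C_β`. -/
def PureC (k : ℕ) (β : Fin 2) : Finset (Finset (I n)) := (C n β).powersetCard k

/-- all relevant monomials in degree `k`. -/
def Rel (k : ℕ) : Finset (Finset (I n)) :=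
  (Finset.univ.biUnion (Mix n k) ∪ Finset.univ.biUnion (PureA n k)) ∪ Finset.univ.biUnion (PureC n k)

variable {n}

/-- membership in the mixed relevant monomials of the pair `p`. -/
lemma mem_Mix {k : ℕ} {p : Fin 2 × Fin 2} {s : Finset (I n)} :
    s ∈ Mix n k p ↔ s ⊆ P n p.1 p.2 ∧ s.card = k ∧ ¬ s ⊆ A n p.1 ∧ ¬ s ⊆ C n p.2 := by
  simp only [Mix, Finset.mem_sdiff, Finset.mem_powersetCard, Finset.mem_union, not_or, not_and]
  tauto

/-- membership in the pure factor-1 monomials of block `α`. -/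
lemma mem_PureA {k : ℕ} {α : Fin 2} {s : Finset (I n)} : s ∈ PureA n k α ↔ s ⊆ A n α ∧ s.card = k :=
  Finset.mem_powersetCard

/-- membership in the pure factor-2 monomials of block `β`. -/
lemma mem_PureC {k : ℕ} {β : Fin 2} {s : Finset (I n)} : s ∈ PureC n k β ↔ s ⊆ C n β ∧ s.card = k :=
  Finset.mem_powersetCard

/-- a relevant monomial is mixed or pure. -/
lemma mem_Rel {k : ℕ} {s : Finset (I n)} :
    s ∈ Rel n k ↔ (∃ p, s ∈ Mix n k p) ∨ (∃ α, s ∈ PureA n k α) ∨ (∃ β, s ∈ PureC n k β) := by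
  simp only [Rel, Finset.mem_union, Finset.mem_biUnion, Finset.mem_univ, true_and, or_assoc]

/-- relevant monomials have cardinality `k`. -/
lemma card_of_mem_Rel {k : ℕ} {s : Finset (I n)} (hs : s ∈ Rel n k) : s.card = k := by
  rcases mem_Rel.mp hs with ⟨p, h⟩ | ⟨α, h⟩ | ⟨β, h⟩
  · exact (mem_Mix.mp h).2.1
  · exact (mem_PureA.mp h).2
  · exact (mem_PureC.mp h).2

/-- a relevant monomial lies inside some transversal pair support. -/
lemma subset_P_of_mem_Rel {k : ℕ} {s : Finset (I n)} (hs : s ∈ Rel n k) : ∃ α β, s ⊆ P n α β := by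
  rcases mem_Rel.mp hs with ⟨p, h⟩ | ⟨α, h⟩ | ⟨β, h⟩
  · exact ⟨p.1, p.2, (mem_Mix.mp h).1⟩
  · exact ⟨α, 0, (mem_PureA.mp h).1.trans Finset.subset_union_left⟩
  · exact ⟨0, β, (mem_PureC.mp h).1.trans Finset.subset_union_right⟩

/-- a subset of `P α β` misses the other factor-1 block. -/
lemma disjoint_A_of_subset_P {s : Finset (I n)} {α β : Fin 2} (h : s ⊆ P n α β) :
    Disjoint s (A n (other α)) := by
  rw [P] at h
  exact Finset.disjoint_of_subset_left h
    (Finset.disjoint_union_left.mpr ⟨disjoint_A_A n (other_ne α).symm, (disjoint_A_C n (other α) β).symm⟩)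

/-- a subset of `P α β` misses the other factor-2 block. -/
lemma disjoint_C_of_subset_P {s : Finset (I n)} {α β : Fin 2} (h : s ⊆ P n α β) :
    Disjoint s (C n (other β)) := by
  rw [P] at h
  exact Finset.disjoint_of_subset_left h
    (Finset.disjoint_union_left.mpr ⟨disjoint_A_C n α (other β), disjoint_C_C n (other_ne β).symm⟩)

/-- canonical factor-1 choice: the block of factor 1 that `s` avoids (preferring `A 0`). -/
noncomputable def αc (s : Finset (I n)) : Fin 2 := if Disjoint s (A n 0) then 0 else 1

/-- canonical factor-2 choice. -/
noncomputable def βc (s : Finset (I n)) : Fin 2 := if Disjoint s (C n 0) then 0 else 1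

/-- `s` misses the factor-1 block `αc s` chosen for it. -/
lemma disjoint_A_αc {s : Finset (I n)} (h : ∃ α, Disjoint s (A n α)) : Disjoint s (A n (αc s)) := by
  unfold αc
  split_ifs with h0
  · exact h0
  · obtain ⟨α, hα⟩ := h
    have : α ≠ 0 := by rintro rfl; exact h0 hα
    have : α = 1 := by omega
    rwa [this] at hα

/-- `s` misses the factor-2 block `βc s` chosen for it. -/
lemma disjoint_C_βc {s : Finset (I n)} (h : ∃ β, Disjoint s (C n β)) : Disjoint s (C n (βc s)) := by
  unfold βc
  split_ifs with h0
  · exact h0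
  · obtain ⟨β, hβ⟩ := h
    have : β ≠ 0 := by rintro rfl; exact h0 hβ
    have : β = 1 := by omega
    rwa [this] at hβ

/-- every relevant monomial is disjoint from its canonical pair support. -/
lemma disjoint_P_canonical {k : ℕ} {s : Finset (I n)} (hs : s ∈ Rel n k) :
    Disjoint s (P n (αc s) (βc s)) := by
  obtain ⟨α, β, h⟩ := subset_P_of_mem_Rel hs
  rw [disjoint_P_iff]
  exact ⟨disjoint_A_αc ⟨other α, disjoint_A_of_subset_P h⟩, disjoint_C_βc ⟨other β, disjoint_C_of_subset_P h⟩⟩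

/-- a `k`-subset (`0 < k`) disjoint from some `P α β` is relevant. -/
lemma mem_Rel_of_disjoint {k : ℕ} {s : Finset (I n)} (hcard : s.card = k) {α β : Fin 2}
    (hd : Disjoint s (P n α β)) : s ∈ Rel n k := by
  -- s lies in the complement A (other α) ∪ C (other β)
  have hsub : s ⊆ P n (other α) (other β) := by
    intro i hi
    rw [disjoint_P_iff] at hd
    have hiA : i ∉ A n α := fun h => (Finset.disjoint_left.mp hd.1) hi h
    have hiC : i ∉ C n β := fun h => (Finset.disjoint_left.mp hd.2) hi h
    rw [P, Finset.mem_union]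
    rcases mem_cover n i with ⟨α', h'⟩ | ⟨β', h'⟩
    · left
      have : α' ≠ α := by rintro rfl; exact hiA h'
      rwa [eq_other_of_ne this] at h'
    · right
      have : β' ≠ β := by rintro rfl; exact hiC h'
      rwa [eq_other_of_ne this] at h'
  rw [mem_Rel]
  by_cases hA : s ⊆ A n (other α)
  · exact Or.inr (Or.inl ⟨other α, mem_PureA.mpr ⟨hA, hcard⟩⟩)
  by_cases hC : s ⊆ C n (other β)
  · exact Or.inr (Or.inr ⟨other β, mem_PureC.mpr ⟨hC, hcard⟩⟩)
  · exact Or.inl ⟨(other α, other β), mem_Mix.mpr ⟨hsub, hcard, hA, hC⟩⟩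

/-! ### Linear independence of the images of the relevant monomials (dual functionals) -/

section Independence

variable {k : ℕ} (c : Fin 2 → Fin 2 → K)

/-- a relevant monomial as an element of `powersetCard`. -/
def relPc (s : Rel n k) : powersetCard (I n) k := ⟨s.1, by rw [mem_iff]; exact card_of_mem_Rel s.2⟩

/-- coercion of `relPc s` is `s`. -/
@[simp] lemma coe_relPc (s : Rel n k) : ((relPc (n := n) s : powersetCard (I n) k) : Finset (I n)) = s.1 :=
  rfl

/-- the image vectors `E_s ∧ v`, `s` relevant. -/
noncomputable def vec (s : Rel n k) : HT K n := B K n (relPc s) * boxClass K n c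

/-- the pivot monomial of a relevant `s`: `s ∪ P(canonical pair)`. -/
noncomputable def piv (s : Rel n k) : Finset (I n) := s.1 ∪ P n (αc s.1) (βc s.1)

/-- the pivot coefficient. -/
noncomputable def pivCoeff (s : Rel n k) : K :=
  c (αc s.1) (βc s.1) * sgn K (relPc s) (Ppc n (αc s.1) (βc s.1))

/-- the pivot coefficient is non-zero when all four box coefficients are. -/
lemma pivCoeff_ne_zero (hc : ∀ α β, c α β ≠ 0) (s : Rel n k) : pivCoeff K c s ≠ 0 := by
  unfold pivCoeff
  refine mul_ne_zero (hc _ _) ((sgn_ne_zero_iff K).mpr ?_)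
  exact disjoint_P_canonical s.2

/-- the dual functionals. -/
noncomputable def fnl (s : Rel n k) : Module.Dual K (HT K n) :=
  (pivCoeff K c s)⁻¹ • (B K n).coord (piv s)

/-- the coordinate of `E_{s'} ∧ v` at the pivot of `s` (requires `k < n`). -/
lemma coord_piv_vec (hkn : k < n) (s s' : Rel n k) :
    (B K n).coord (piv s) (vec K c s') = if s' = s then pivCoeff K c s else 0 := by
  classical
  rw [vec, coord_B_mul_boxClass]
  have hcard : s.1.card < n := by rw [card_of_mem_Rel s.2]; exact hkn
  have hds : Disjoint s.1 (P n (αc s.1) (βc s.1)) := disjoint_P_canonical s.2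
  -- each term: non-zero only if s' ∪ P α β = piv s with s' disjoint from P α β, forcing everything
  have hterm : ∀ α β, c α β * sgn K (relPc s') (Ppc n α β) *
      (if (relPc (n := n) s').val ∪ P n α β = piv s then (1 : K) else 0) =
      if s' = s ∧ α = αc s.1 ∧ β = βc s.1 then pivCoeff K c s else 0 := by
    intro α β
    by_cases hd : Disjoint (relPc (n := n) s').val (P n α β)
    · by_cases he : (relPc (n := n) s').val ∪ P n α β = piv s
      · -- KEY applies
        obtain ⟨hα, hβ, hss⟩ := key (s := s.1) hcard hds hd he
        have hs's : s' = s := Subtype.ext hss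
        rw [if_pos he, mul_one, if_pos ⟨hs's, hα, hβ⟩, pivCoeff, hs's, hα, hβ]
      · rw [if_neg he, mul_zero, if_neg]
        rintro ⟨rfl, rfl, rfl⟩
        exact he rfl
    · rw [sgn_of_not_disjoint K hd, mul_zero, zero_mul, if_neg]
      rintro ⟨rfl, rfl, rfl⟩
      exact hd hds
  simp_rw [hterm]
  by_cases hs : s' = s
  · simp only [hs, true_and, if_true]
    rw [Finset.sum_eq_single (αc s.1) (fun α _ hα => by simp [hα]) (by simp),
      Finset.sum_eq_single (βc s.1) (fun β _ hβ => by simp [hβ]) (by simp)]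
    simp
  · simp [hs]

/-- the dual functionals are a dual family to the images of the relevant monomials (`k < n`). -/
lemma fnl_vec (hkn : k < n) (hc : ∀ α β, c α β ≠ 0) (s s' : Rel n k) :
    fnl K c s (vec K c s') = if s' = s then 1 else 0 := by
  rw [fnl, LinearMap.smul_apply, coord_piv_vec K c hkn, smul_eq_mul]
  split_ifs with h
  · exact inv_mul_cancel₀ (pivCoeff_ne_zero K c hc s)
  · exact mul_zero _

/-- the images of the relevant monomials are linearly independent (`k < n`). -/
theorem vec_linearIndependent (hkn : k < n) (hc : ∀ α β, c α β ≠ 0) :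
    LinearIndependent K (vec K (n := n) (k := k) c) := by
  apply LinearIndependent.of_pairwise_dual_eq_zero_one _ (fnl K c)
  · intro s s' hss'
    rw [fnl_vec K c hkn hc, if_neg (Ne.symm hss')]
  · intro s
    rw [fnl_vec K c hkn hc, if_pos rfl]

/-! ### The range is spanned by the images of the relevant monomials. -/

/-- the range of `θ ↦ θ ∧ boxClass` on `⋀^k` is spanned by the images of the relevant monomials. -/
theorem range_eq_span_vec :
    LinearMap.range (wedgeMap K n k (boxClass K n c)) = Submodule.span K (Set.range (vec K (n := n) (k := k) c)) := by
  apply le_antisymm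
  · rw [range_wedgeMap, Submodule.span_le]
    rintro _ ⟨s, rfl⟩
    rw [SetLike.mem_coe]
    change B K n s * boxClass K n c ∈ _
    by_cases hrel : ∃ α β, Disjoint s.val (P n α β)
    · obtain ⟨α, β, hd⟩ := hrel
      have hs : (s : Finset (I n)) ∈ Rel n k := mem_Rel_of_disjoint (card_eq s) hd
      have : B K n s * boxClass K n c = vec K c ⟨s, hs⟩ := rfl
      rw [this]
      exact Submodule.subset_span ⟨_, rfl⟩
    · -- every term vanishes
      simp only [not_exists] at hrel
      rw [B_mul_boxClass]
      refine Submodule.sum_mem _ fun α _ => Submodule.sum_mem _ fun β _ => ?_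
      rw [sgn_of_not_disjoint K (hrel α β), mul_zero, zero_smul]
      exact Submodule.zero_mem _
  · rw [Submodule.span_le]
    rintro _ ⟨s, rfl⟩
    rw [SetLike.mem_coe, vec]
    have := LinearMap.mem_range_self (wedgeMap K n k (boxClass K n c))
      ⟨B K n (relPc s), B_mem_exteriorPower K (relPc s)⟩
    rwa [wedgeMap_apply] at this

/-- rank = number of relevant monomials (`k < n`). -/
theorem finrank_range_eq_card_Rel (hkn : k < n) (hc : ∀ α β, c α β ≠ 0) :
    Module.finrank K (LinearMap.range (wedgeMap K n k (boxClass K n c))) = (Rel n k).card := by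
  rw [range_eq_span_vec K c, finrank_span_eq_card (vec_linearIndependent K c hkn hc), Fintype.card_coe]

end Independence

/-! ### Counting the relevant monomials: `card Rel = 4·C(2n,k) − 4·C(n,k)` for `0 < k`. -/

end Summit.Ventures.HSemireg.WedgeBox
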